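import Summits.ABC.IUTFork.Repair.RHReachLedgerBookkeeping
import Summits.ABC.IUTFork.Repair.RHReachLedger
import HarnessLib

/-!
# R-H ROUND 2 row 27 «reach-ledger» — (β) applied: `HStarReachLedger` ∧ (α) ⟹ the typed [IUTchIII] Cor. 3.12 `Statement` at `settingPrVolSharp`
# (`K2Target27` reduces BY NAME to the realisation binder (α))

PROOF-ONLY companion (0 definitions, 0 `Prop` facts) of `Repair/RHReachLedgerBookkeeping.lean` (abc-iut cell, D-0079 RESCUE sub-cell R-H, rung
LADDER-ABC:A2.RESCUE.H; pair n = 10 typer abc-iut-rh-typ-10, row-27 support base). TAKES NO SIDE on [IUTchIII] Cor. 3.12 or on any author;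
typed ≠ proved; instantiated ≠ endorsed; nothing here asserts abc proved or refuted. Row 27's `RH.ReachLedger.HStarReachLedger`
(abc-iut-lens-nearmiss-1, p464022) is an R-H CANDIDATE = a HYPOTHESIS SHAPE, never asserted; (α) is a HYPOTHESIS BINDER, not proved here.

* `ledgerSum_eq_sum` — row 27's list-fold ledger `ledgerSum l⋆ p e m_q` IS the `Fin l⋆`-indexed sum of the cell levels `⌊cellReachSlack_{i+1}/e⌋`.
* `statement_settingPrVolSharp_of_hStarReachLedger` — ROW 27 THROUGH DOOR (b): `HStarReachLedger l⋆ Fib (placeOf ∈ S) e m_q` (per-place budget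
  at the bad places) ∧ (α: per label `i` a q-idele family `t_q'^{(i)}`, units off `S`, with `‖t_q'^{(i)}(x)‖ = ‖t_q(x)‖·p^{cellReachSlack_{i+1}(x)/e_x}`
  at the bad places over the bad primes `W ⊇ {p : some bad x ∣ p}`, MULTI-REACHED by the (Ind2)-movers at every packet over `W` — abc-iut-w5-d107's
  binder verbatim) ∧ `‖t_Θ‖ = 1` off `S` ⟹ `Cor312.Setting.Statement (settingPrVolSharp …)`, by the parent file's
  `statement_settingPrVolSharp_of_placeLedger` (L1 `RH.ReachLedgerVolume.levels_le_cellSlack` per packet + last-slot marginal + generic door)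
  and `cellSlack_nonneg_settingPrVolSharp_of_good` (primes without bad places are free). HENCE abc-iut-rh-typ-10's kernel target
  `RH.ReachLedgerQ2.K2Target27` (p468994, «S|Σ₂₇ ⇒ Cor 3.12|Σ₂₇») reduces BY NAME to (α) at the genuine bed `Cor312Prov.pilotDataOfK` (plus
  the bed's dictionary binders — realising ideles, `ramificationIdx ≥ 1`, q-pilot degrees — as discharged for row 15 in abc-iut-rh2-q2-hull's
  `RH2SigmaHull`). (α) — whether the (Ind2)-movers ATTAIN the ledger's integers `(j+1)·D(p,e_w) − (j²−1)·m_q − e_w`, in particular at MIXED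
  tuples whose donor slots sit at places of different local type over the same `p` — is row 27's open crux and is NOT claimed.
[cite: DupuyHilado2025, §3.6, §3.9, §4.9] [cite: Mochizuki2012, IUTchIII Cor. 3.12 p. 173–174; Rmk. 3.9.3 pp. 119–120]
[claim: Mochizuki2012, status: disputed] for every IUT sentence quoted. Axioms: standard.
-/

noncomputable section

open Set Function
open scoped Pointwise

namespace Summit.ABC.IUTFork.Repair.RH.ReachLedgerBookkeeping

open Cor312 Cor312Vol Literature.IUT.LogThetaLattice Literature.IUT.LogVolume NumberField IsDedekindDomain
  Summit.ABC.IUTFork.Thm311 Summit.ABC.IUTFork.Thm311.Real Summit.ABC.IUTFork.Repair.RH.ReachLedger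
  Summit.ABC.IUTFork.Repair.RH.ReachLedgerVolume

/-! ## §4. Row 27: the per-place LEDGER `HStarReachLedger` as the budget — `K2Target27` reduces to (α) BY NAME -/

section RowTwentySeven

/-- Row 27's list-fold ledger is the `Fin l⋆`-indexed sum of the cell levels: `ledgerSum l⋆ p e m_q = Σ_{i : Fin l⋆} ⌊cellReachSlack_{i+1}/e⌋`. [folklore] -/
theorem ledgerSum_eq_sum (lstar p e : ℕ) (mq : ℤ) :
    ledgerSum lstar p e mq = ∑ i : Fin lstar, cellLevels p e ((i : ℕ) + 1) mq := by
  induction lstar with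
  | zero => simp [ledgerSum]
  | succ k ih =>
    rw [Fin.sum_univ_castSucc]
    simp only [Fin.val_castSucc, Fin.val_last]
    rw [← ih]
    simp [ledgerSum, List.range_succ, List.map_append, List.sum_append]

variable {F : Type} [Field F] [NumberField F] (X : PilotData F) {logv : PadicLogs F} (hlog : LogvAnalytic logv)
  (M : Type) [Field M] [NumberField M]
  (archPk : ∀ (j : (thetaIndex X).Label) (vQ : (thetaIndex X).VQ), Set ((logShellsDH X logv).Packet j vQ))
  (archSub : ∀ (j : (thetaIndex X).Label) (v : (thetaIndex X).V),
    Set ((logShellsDH X logv).Packet j ((thetaIndex X).over v)))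
  (Ψ : ℤ → ∀ v : (thetaIndex X).V, v ∈ (thetaIndex X).Vbad → Set ((logShellsDH X logv).StarPacket v))
  (act : ℤ → ∀ v : (thetaIndex X).V, v ∈ (thetaIndex X).Vbad →
    (logShellsDH X logv).StarPacket v → Module.End ℚ ((logShellsDH X logv).StarPacket v))
  (Mmod : ℤ → ∀ j : (thetaIndex X).LabelStar, Set ((logShellsDH X logv).GlobalPacket j.1))
  (region : ℤ → ∀ j : (thetaIndex X).LabelStar, FinDivisor M → ∀ vQ : (thetaIndex X).VQ,
    Set ((logShellsDH X logv).Packet j.1 vQ))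
  (n : ℤ) {HT : Type} {LogLink : HT → HT → Type} {IsFull : ∀ {s t : HT}, LogLink s t → Prop}
  (lat : LGPGaussianLogThetaLattice LogLink IsFull)
  {Frd : Type} {IsoF : Frd → Frd → Type} {Ob : Frd → Type} {realify : Frd → Frd} {Strip : Type}
  {IsoS : Strip → Strip → Type} {Mv : ∀ v : (thetaIndex X).V, v ∈ (thetaIndex X).Vbad → Type}
  [∀ v h, Monoid (Mv v h)]
  (sig : GlobalLGPFrobenioidSignature (thetaIndex X).lstar (thetaIndex X).V (· ∈ (thetaIndex X).Vbad)
    Frd IsoF Ob realify Strip IsoS Mv)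
  (split : SplittingMonoids Mv) {ObΔ : Type} {N : ∀ v : (thetaIndex X).V, v ∈ (thetaIndex X).Vbad → Type}
  [∀ v h, Monoid (N v h)] (qData : QPilotData ObΔ N)
  (tq : ∀ (pp : Nat.Primes) (x : (thetaIndex X).Fibre (.inr pp)), haveI : Fact (pp : ℕ).Prime := ⟨pp.2⟩; kOf X pp.1 x)
  (t : ∀ (pp : Nat.Primes) (_ : Fin X.lstar) (x : (thetaIndex X).Fibre (.inr pp)),
    haveI : Fact (pp : ℕ).Prime := ⟨pp.2⟩; kOf X pp.1 x)
  (htq0 : ∀ pp x, tq pp x ≠ 0)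
  (htq1 : ∀ (pp : Nat.Primes) (x : (thetaIndex X).Fibre (.inr pp)),
    haveI : Fact (pp : ℕ).Prime := ⟨pp.2⟩; placeOf X pp.1 x ∉ X.S → ‖tq pp x‖ = 1)

/-- **ROW 27 THROUGH DOOR (b): `HStarReachLedger` ∧ (α) ⟹ STATEMENT at `settingPrVolSharp`.** With row 27's dictionary (`e_x ≥ 1` the unit of
account, `m_q(x)` the Kummer-root order) and abc-iut-lens-nearmiss-1's candidate `RH.ReachLedger.HStarReachLedger` (p464022: at every BAD place
`0 ≤ Σ_{j=1}^{l⋆} ⌊cellReachSlack_j(x)/e_x⌋`, bad := `placeOf x ∈ S`) as the per-place budget: IF (α) for every label `i` a q-idele family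
`t_q'^{(i)}` REALISES the ledger's integers — `‖t_q'^{(i)}(x)‖ = ‖t_q(x)‖·p^{cellReachSlack_{i+1}(x)/e_x}` at the bad places over the bad primes
`W ⊇ {p : some bad x ∣ p}`, units off `S`, multi-reached by the (Ind2)-movers at every packet over `W` — and the Θ-ideles are units off `S`
(`ht1`), THEN the typed [IUTchIII] Cor. 3.12 `Statement` holds. So `RH.ReachLedgerQ2.K2Target27` (p468994) reduces BY NAME to (α) (plus the
genuine bed's dictionary binders). (α) is NOT proved here. [cite: DupuyHilado2025, §3.6, §3.9, §4.9]
[cite: Mochizuki2012, IUTchIII Cor. 3.12 p. 173–174; Rmk. 3.9.3 pp. 119–120] [claim: Mochizuki2012, status: disputed] -/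
theorem statement_settingPrVolSharp_of_hStarReachLedger
    (hmono : LogvolMono (settingPrVolSharp X hlog M archPk archSub Ψ act Mmod region n lat sig split qData tq t htq0 htq1))
    (hfin : (settingPrVolSharp X hlog M archPk archSub Ψ act Mmod region n lat sig split qData tq t htq0 htq1).ThetaFinite)
    (ht1 : ∀ (pp : Nat.Primes) (i : Fin X.lstar) (x : (thetaIndex X).Fibre (.inr pp)),
      haveI : Fact (pp : ℕ).Prime := ⟨pp.2⟩; placeOf X pp.1 x ∉ X.S → ‖t pp i x‖ = 1)
    (W : Finset Nat.Primes)
    (hW : ∀ (pp : Nat.Primes) (x : (thetaIndex X).Fibre (.inr pp)), haveI : Fact (pp : ℕ).Prime := ⟨pp.2⟩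
      placeOf X pp.1 x ∈ X.S → pp ∈ W)
    (eIdx : ∀ pp : Nat.Primes, (thetaIndex X).Fibre (.inr pp) → ℕ) (heIdx : ∀ pp x, 1 ≤ eIdx pp x)
    (mq : ∀ pp : Nat.Primes, (thetaIndex X).Fibre (.inr pp) → ℤ)
    (hH : HStarReachLedger (thetaIndex X).lstar (fun pp => (thetaIndex X).Fibre (.inr pp))
      (fun pp w => haveI : Fact (pp : ℕ).Prime := ⟨pp.2⟩; placeOf X pp.1 w ∈ X.S) eIdx mq)
    (tq' : ∀ (_ : Fin (thetaIndex X).lstar) (pp : Nat.Primes) (x : (thetaIndex X).Fibre (.inr pp)),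
      haveI : Fact (pp : ℕ).Prime := ⟨pp.2⟩; kOf X pp.1 x)
    (htq0' : ∀ i pp x, tq' i pp x ≠ 0)
    (htq1' : ∀ (i : Fin (thetaIndex X).lstar) (pp : Nat.Primes) (x : (thetaIndex X).Fibre (.inr pp)),
      haveI : Fact (pp : ℕ).Prime := ⟨pp.2⟩; placeOf X pp.1 x ∉ X.S → ‖tq' i pp x‖ = 1)
    (hreal : ∀ pp ∈ W, ∀ (i : Fin (thetaIndex X).lstar) (x : (thetaIndex X).Fibre (.inr pp)),
      haveI : Fact (pp : ℕ).Prime := ⟨pp.2⟩; placeOf X pp.1 x ∈ X.S →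
      ‖tq' i pp x‖ = ‖tq pp x‖ * ((pp : ℕ) : ℝ) ^
        ((cellReachSlack (pp : ℕ) (eIdx pp x) ((i : ℕ) + 1) (mq pp x) : ℝ) / (eIdx pp x : ℝ)))
    (hreach : ∀ pp ∈ W, ∀ (i : Fin (thetaIndex X).lstar), haveI : Fact (pp : ℕ).Prime := ⟨pp.2⟩
      ∀ e : (thetaIndex X).Caps (Setting.labelSucc i) → (thetaIndex X).Fibre (.inr pp),
        ∃ g : (thetaIndex X).Caps (Setting.labelSucc i) → ∀ x : (thetaIndex X).Fibre (.inr pp),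
            (logShellsDH X logv).carrier x.1 ≃ₗ[ℚ] (logShellsDH X logv).carrier x.1,
          (∀ a x, g a x ∈ (logShellsDH X logv).ism x.1) ∧
          ∃ y : ∀ a, kOf X pp.1 (e a), (∀ a, ‖y a‖ ≤ 1) ∧
            ‖tq' i pp (e (Fin.last _))‖ ≤ ∏ a, ‖(presAt X hlog pp).φ (e a) (g a (e a) (((presAt X hlog pp).φ (e a)).symm
              ((if a = Fin.last _ then t pp i (e a) else 1) * y a)))‖) :
    (settingPrVolSharp X hlog M archPk archSub Ψ act Mmod region n lat sig split qData tq t htq0 htq1).Statement := by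
  classical
  -- the level gains: the ledger's integers at the bad places, `0` at the good ones
  let s : ∀ pp : Nat.Primes, Fin (thetaIndex X).lstar → (thetaIndex X).Fibre (.inr pp) → ℤ := fun pp i x =>
    haveI : Fact (pp : ℕ).Prime := ⟨pp.2⟩
    if placeOf X pp.1 x ∈ X.S then cellReachSlack (pp : ℕ) (eIdx pp x) ((i : ℕ) + 1) (mq pp x) else 0
  refine statement_settingPrVolSharp_of_placeLedger X hlog M archPk archSub Ψ act Mmod region n lat sig split qData tq t htq0 htq1
    hmono hfin W eIdx heIdx s tq' htq0' htq1' (fun pp hpp i x => ?_) hreach (fun pp hpp i => ?_) (fun pp hpp x => ?_)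
  · -- the norm relation: the ledger's gain at bad `x`, none at good `x`
    haveI : Fact (pp : ℕ).Prime := ⟨pp.2⟩
    by_cases hx : placeOf X pp.1 x ∈ X.S
    · have hs : s pp i x = cellReachSlack (pp : ℕ) (eIdx pp x) ((i : ℕ) + 1) (mq pp x) := if_pos hx
      rw [hs]
      exact hreal pp hpp i x hx
    · have hs : s pp i x = 0 := if_neg hx
      rw [hs, htq1' i pp x hx, htq1 pp x hx, Int.cast_zero, zero_div, Real.rpow_zero, mul_one]
  · -- primes off `W` carry no bad place
    exact cellSlack_nonneg_settingPrVolSharp_of_good X hlog M archPk archSub Ψ act Mmod region n lat sig split qData tq t htq0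
      htq1 hmono hfin ht1 pp (fun x hx => hpp (hW pp x hx)) i
  · -- the per-place ledger: row 27's cell at bad `x`, zero at good `x`
    haveI : Fact (pp : ℕ).Prime := ⟨pp.2⟩
    by_cases hx : placeOf X pp.1 x ∈ X.S
    · have hcell := hH pp x hx
      unfold LedgerCell at hcell
      rw [ledgerSum_eq_sum] at hcell
      refine hcell.trans_eq (Finset.sum_congr rfl fun i _ => ?_)
      have hs : s pp i x = cellReachSlack (pp : ℕ) (eIdx pp x) ((i : ℕ) + 1) (mq pp x) := if_pos hx
      rw [hs]
      rfl
    · refine Finset.sum_nonneg fun i _ => ?_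
      have hs : s pp i x = 0 := if_neg hx
      rw [hs, Int.zero_ediv]

end RowTwentySeven

end Summit.ABC.IUTFork.Repair.RH.ReachLedgerBookkeeping

end
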